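import Literature.NumberTheory.EllipticCurves.BSDAnalyticRankTunnellProofs
import HarnessLib

/-!
# Tunnell's Theorem 3 one level down: Waldspurger's proportionality and four `L`-values

Third sibling proof file of `Literature.NumberTheory.EllipticCurves.BSDAnalyticRank`, below the
named facts `Literature.NumberTheory.EllipticCurves.Tunnell1983_L_one_odd` / `Literature.NumberTheory.EllipticCurves.Tunnell1983_L_one_even` (**Tunnell 1983,
Theorem 3**: for `d` squarefree, odd and positive, `L(E^d, 1) = a(d)² β d^{-1/2}/4` and
`L(E^{2d}, 1) = b(d)² β (2d)^{-1/2}/2`), which are the deep input of both directions of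
**bsd.S29** (Tunnell's theorem: `Literature.BSD.tunnell_even/odd` via `BSDWave0TunnellProofs`, and
`Literature.tunnell_converse_even/odd` via `BSDAnalyticRankTunnellProofs`). This file follows the
printed proof of Theorem 3 (Invent. Math. 72, p. 329) and PROVES Theorem 3 from the two
statements that proof combines, each vendored as a named fact with Tunnell's own wording:

* `Literature.NumberTheory.EllipticCurves.Tunnell1983_a_sq_eq_const_mul_L_one` / `Literature.NumberTheory.EllipticCurves.Tunnell1983_b_sq_eq_const_mul_L_one` —
  **Waldspurger's theorem specialised to `g θ₂`, `g θ₄`** (Tunnell p. 329, the displays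
  "`a(n)² = β₁² L(Eⁿ, 1) n^{1/2}`, `n ≡ 1 (8)`; `a(n)² = β₃² L(Eⁿ, 1) n^{1/2}`, `n ≡ 3 (8)`;
  `a(n)² = 0 = A(n)² = L(Eⁿ, 1)`, `n ≡ 5, 7 (8)`" for `n` square-free, and, for the character
  `χ₂`, "`A(t)² = L(φ χ₂ χ_t, 1) = L(E^{2t}, 1)` … `A(n) = 0` when `n ≡ 3, 7` modulo `8` and
  `b(n) = γ₁ A(n) n^{1/4}`, `n ≡ 1 (8)`, `b(n) = γ₅ A(n) n^{1/4}`, `n ≡ 5 (8)`"): on each odd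
  class modulo `8` the square of the coefficient is a constant multiple of `L(·, 1) √n`, the
  constants being unspecified complex numbers. This is exactly what Waldspurger's Theorem 1
  ([25], J. Math. Pures Appl. 60 (1981)), applied to the Shimura lifts of Theorem 2, delivers
  (Tunnell p. 328, "Theorem (Waldspurger)", (i)–(ii), and p. 329, ll. 1–12);
* `Literature.NumberTheory.EllipticCurves.BirchSwinnertonDyer1965_L_one_one_three` / `Literature.NumberTheory.EllipticCurves.BirchSwinnertonDyer1965_L_one_two_ten` —
  **the four `L`-values that fix the constants** (Tunnell p. 329: "It is shown in [3, Table 1]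
  that `L(Eⁿ, 1) n^{1/2}/β` is rational, and a table is given for certain `n`. In particular
  `L(E, 1)/β = 1/4` and `L(E³, 1) 3^{1/2}/β = 1`" and "comparing with the tables of [3] to find
  `L(E², 1)` and `L(E¹⁰, 1)` verifies the theorem"; Birch–Swinnerton-Dyer, *Notes on elliptic
  curves II*, Crelle 218 (1965), (1.6): `L_D(1) = D^{-1/4} ω σ(D)` (`D > 0`) for
  `Γ_D : y² = x³ - Dx`, `ω` the real period of `℘'² = 4℘³ - 4℘` (`= β`), and Table 1:
  `σ(1) = ¼`, `σ(9) = 1`, and, in the column `-D` whose entries are also those of `-4(-D) = 4D`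
  (p. 100), `σ = ½` at `D₀ = 1` and `σ = 2` at `D₀ = 25`, i.e. `L(E², 1) = 4^{-1/4} β/2 = β/(2√2)`
  and `L(E¹⁰, 1) = 100^{-1/4} β · 2 = 2β/√10`): `L(E₁, 1) = β/4`, `L(E₃, 1) = β/√3`,
  `L(E₂, 1) = β/(2√2)`, `L(E₁₀, 1) = 2β/√10`.

Everything else on p. 329 is PROVED here:

* `Literature.NumberTheory.EllipticCurves.Tunnell1983.a_three`, `Literature.NumberTheory.EllipticCurves.Tunnell1983.b_five` — "`a(3) = 2`" (printed, p. 329) and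
  `b(5) = 2` (the value used with `L(E¹⁰, 1)`), from the ternary-form definitions
  (`Literature.NumberTheory.EllipticCurves.ternaryFormRepCount_eq_four`: `#{a x² + y² + c z² = a + 1} = 4` for `a + 1 < c`,
  `a + 1` not a square);
* `Literature.NumberTheory.EllipticCurves.Tunnell1983.a_eq_zero_of_mod_eight`, `Literature.NumberTheory.EllipticCurves.Tunnell1983.b_eq_zero_of_mod_eight` —
  "`a(n) = 0` unless `n ≡ 1` or `3` modulo `8` and `b(n) = 0` unless `n ≡ 1` or `5` modulo `8`"
  (p. 329, last paragraph) for odd `n`, by congruences modulo `8`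
  (`Literature.NumberTheory.EllipticCurves.ternaryFormRepCount_eq_zero_of_mod_eight`, a `decide` over `(ℤ/8)³`);
* `Literature.NumberTheory.EllipticCurves.Tunnell1983_L_one_odd_of_facts`, `Literature.NumberTheory.EllipticCurves.Tunnell1983_L_one_even_of_facts` — **Theorem 3
  from the two named facts** and the continuation of `L(E_n, s)` for squarefree `n`
  (`Literature.NumberTheory.EllipticCurves.hasEntireLFunction_congruentNumberCurve`, needed only to instantiate the facts at
  `n = 1, 3`, resp. `2, 10`): "Since `a(1) = 1` and `a(3) = 2` this shows that
  `4/β = β₁² = β₃²`" (p. 329), and likewise `γ₁² = γ₅² = 2√2/β` from `b(1) = 1`, `b(5) = 2`;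
* `Literature.NumberTheory.EllipticCurves.Tunnell1983_a_sq_eq_const_mul_L_one_of_L_one_odd`,
  `Literature.NumberTheory.EllipticCurves.BirchSwinnertonDyer1965_L_one_one_three_of_L_one_odd`,
  `Literature.NumberTheory.EllipticCurves.Tunnell1983_L_one_odd_iff_facts` (and the even analogues) — **conversely,
  Theorem 3 returns both inputs** (it exhibits the constants `4/β`, resp. `2√2/β`, and at
  `d = 1, 3`, resp. `1, 5`, the four `L`-values), so over the continuation
  `Tunnell1983_L_one_odd ↔ Tunnell1983_a_sq_eq_const_mul_L_one ∧ BirchSwinnertonDyer1965_L_one_one_three`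
  and `Tunnell1983_L_one_even ↔ Tunnell1983_b_sq_eq_const_mul_L_one ∧ BirchSwinnertonDyer1965_L_one_two_ten`:
  a discharge of Theorem 3 by any route discharges the four named facts of this file.

So `Tunnell1983_L_one_odd/even` now stand behind: Waldspurger's proportionality for the two
pairs of weight-`3/2` forms (a theory away from Mathlib v4.32.0: forms of half-integral weight,
Hecke operators `T(p²)`, the Shimura correspondence, Waldspurger 1981 — none of which exist in
Mathlib or in this library), four classical CM `L`-values (Birch–Swinnerton-Dyer 1965, §3:
finite expressions of `L_D(1)` through division values of `℘`; approachable once `L(E_n, s)` is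
identified with a Hecke `L`-series of `ℚ(i)`, the route of `CongruentNumberCurveSupersingular`),
and the continuation of `L(E_n, s)`.

## Architecture of the printed proof (Tunnell 1983, pp. 328–329)

Theorem 2 (p. 327): `g θ₂`, `g θ₈` (trivial character) and `g θ₄`, `g θ₁₆` (character `χ₂`)
are Hecke eigenforms of weight `3/2` and level `128` whose Shimura lift is the newform `φ` of
weight `2` and level `32` (`L(E, s) = L(φ, s)`, `L(E^d, s) = L(φ ⊗ χ_d, s)`, p. 325).
Waldspurger's theorem (p. 328): there is `A(t)` on squarefree `t` with
`A(t)² ε(…) = 2 (2π)^{(1-k)/2} Γ((k-1)/2) L(φ χ⁻¹ χ₋₁^{(k-1)/2} χ_t, (k-1)/2)` and the series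
`∑ A(n^{sf}) c(n) qⁿ`, `c(n) = n^{1/4} ∏ c_p(n)` with `c₂` the characteristic function of an odd
class modulo `8` (p. 329, [25, VIII.4]), span the weight-`3/2` forms corresponding to `φ`.
Comparing with the basis of Theorem 2 gives the three displays quoted above (odd case) and
their `χ₂`-analogues (even case). The constants are then computed from `a(1) = 1`, `a(3) = 2`,
`L(E, 1) = β/4`, `L(E³, 1) = β/√3` [3, Table 1]: `β₁² = β₃² = 4/β`, whence
`L(Eⁿ, 1) = a(n)²/(β₁² √n) = a(n)² β/(4√n)` on the classes `1, 3`, and `L(Eⁿ, 1) = 0 = a(n)`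
on the classes `5, 7`; the even case uses `b(1) = 1`, `b(5) = 2`, `L(E², 1) = β/(2√2)`,
`L(E¹⁰, 1) = 2β/√10`, so `γ₁² = γ₅² = 2√2/β` and `L(E^{2n}, 1) = b(n)² β/(2√2 √n) =
b(n)² β (2n)^{-1/2}/2`.

## Design

* The constants `β₁², β₃², γ₁², γ₅²` are existentially quantified complex numbers (`A(t) ∈ ℂ`,
  p. 328); nothing printed is lost, since Theorem 3 recovers them. As in the sibling files,
  `L(E_n, 1)` is `(congruentNumberCurve n).entireLFunction 1` under the junk-value guard
  `(congruentNumberCurve n).HasEntireLFunction`, and `E^{2n}` is `congruentNumberCurve (2 * n)`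
  as in `Tunnell1983_L_one_even`.
* The four `L`-values are stated for the tree's models `E_n : y² = x³ - n² x`
  (`E₂ : y² = x³ - 4x = Γ₄`, `E₁₀ = Γ₁₀₀`), with `β = Literature.tunnellPeriod = ∫₁^∞ dx/√(x³ - x)`,
  which is the real period `ω` of `℘'² = 4℘³ - 4℘` (`ω = 2 ∫₁^∞ dx/√(4x³ - 4x) = β`; Tunnell
  p. 329 "`β` … is the real period of `E`").

## References

* J. B. Tunnell, *A classical Diophantine problem and modular forms of weight 3/2*, Invent.
  Math. 72 (1983) 323–334: Theorem (Waldspurger) and Theorem 3 (p. 328), proof of Theorem 3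
  (p. 329). Read on the GDZ scan of Inventiones 72 (`PPN356556735_0072`, `LOG_0021`).
* B. J. Birch, H. P. F. Swinnerton-Dyer, *Notes on elliptic curves. II*, J. reine angew. Math.
  218 (1965) 79–108: (1.6) (p. 80), remark on `-4D` (p. 100), Table 1 (p. 101). Read on the
  GDZ scan of Crelle 218 (`PPN243919689_0218`).
* J.-L. Waldspurger, *Sur les coefficients de Fourier des formes modulaires de poids
  demi-entier*, J. Math. Pures Appl. 60 (1981) 375–484, Thm 1 (Tunnell's [25]).
-/

noncomputable section

open scoped Classical

open WeierstrassCurve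

namespace Literature.NumberTheory.EllipticCurves

/-! ### Representation numbers: congruences modulo `8` and the value `4` -/

/-- If `a x² + y² + c z² ≡ r (mod 8)` has no solution in `ℤ/8`, then `#{a x² + y² + c z² = n} = 0`
for every `n ≡ r (mod 8)` (reduction modulo `8`). [folklore] -/
theorem ternaryFormRepCount_eq_zero_of_mod_eight {a c : ℤ} {n r : ℕ} (hr : n % 8 = r)
    (h : ∀ x y z : ZMod 8, (a : ZMod 8) * x ^ 2 + y ^ 2 + (c : ZMod 8) * z ^ 2 ≠ (r : ZMod 8)) :
    Literature.NumberTheory.EllipticCurves.ternaryFormRepCount a 1 c n = 0 := by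
  unfold Literature.NumberTheory.EllipticCurves.ternaryFormRepCount
  have hempty : {v : ℤ × ℤ × ℤ | a * v.1 ^ 2 + 1 * v.2.1 ^ 2 + c * v.2.2 ^ 2 = (n : ℤ)} = ∅ := by
    ext ⟨x, y, z⟩
    simp only [Set.mem_setOf_eq, Set.mem_empty_iff_false, iff_false, one_mul]
    intro hxyz
    apply h (x : ZMod 8) (y : ZMod 8) (z : ZMod 8)
    have h8 := congrArg (fun t : ℤ ↦ (t : ZMod 8)) hxyz
    push_cast at h8
    rw [h8, ← hr, ZMod.natCast_mod n 8]
  rw [hempty, Set.ncard_empty]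

/-- `#{a x² + y² + c z² = n} = 4` when `n = a + 1 < c`, `a > 0` and `n` is not a square: the
solutions are `(±1, ±1, 0)` (`z = 0` as `c > n`; `x = 0` would make `n = y²`; `a x² ≤ a + 1`
forces `x = ±1`, then `y² = 1`). Used for `a(3)` and `b(5)`. [folklore] -/
theorem ternaryFormRepCount_eq_four {a c n : ℤ} (ha : 0 < a) (hn : n = a + 1) (hnc : n < c)
    (hsq : ∀ y : ℤ, y ^ 2 ≠ n) : Literature.NumberTheory.EllipticCurves.ternaryFormRepCount a 1 c n = 4 := by
  unfold Literature.NumberTheory.EllipticCurves.ternaryFormRepCount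
  have hset : {v : ℤ × ℤ × ℤ | a * v.1 ^ 2 + 1 * v.2.1 ^ 2 + c * v.2.2 ^ 2 = n} =
      ↑({((1 : ℤ), (1 : ℤ), (0 : ℤ)), (1, -1, 0), (-1, 1, 0), (-1, -1, 0)} :
        Finset (ℤ × ℤ × ℤ)) := by
    ext ⟨x, y, z⟩
    simp only [Set.mem_setOf_eq, Finset.coe_insert, Finset.coe_singleton, Set.mem_insert_iff,
      Set.mem_singleton_iff, Prod.mk.injEq]
    constructor
    · intro h
      have hx2 : 0 ≤ x ^ 2 := sq_nonneg x
      have hy2 : 0 ≤ y ^ 2 := sq_nonneg y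
      have hz2 : 0 ≤ z ^ 2 := sq_nonneg z
      have hz : z = 0 := by
        by_contra hz
        have h1 : 1 ≤ z ^ 2 := (one_le_sq_iff_one_le_abs z).2 (Int.one_le_abs hz)
        nlinarith
      subst hz
      have hx : x ≠ 0 := by
        rintro rfl
        apply hsq y
        linear_combination h
      have hx1 : 1 ≤ x ^ 2 := (one_le_sq_iff_one_le_abs x).2 (Int.one_le_abs hx)
      have hxx : x = 1 ∨ x = -1 := by
        have h1 : -2 < x := by nlinarith
        have h2 : x < 2 := by nlinarith
        interval_cases x <;> simp_all
      have hy1 : y ^ 2 = 1 := by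
        rcases hxx with rfl | rfl <;> linear_combination h + hn
      have hyy : y = 1 ∨ y = -1 := by
        have h' : (y - 1) * (y + 1) = 0 := by linear_combination hy1
        rcases mul_eq_zero.1 h' with h' | h'
        · left; linarith
        · right; linarith
      rcases hxx with rfl | rfl <;> rcases hyy with rfl | rfl <;> simp
    · rintro (⟨rfl, rfl, rfl⟩ | ⟨rfl, rfl, rfl⟩ | ⟨rfl, rfl, rfl⟩ | ⟨rfl, rfl, rfl⟩) <;>
        linear_combination -hn
  rw [hset, Set.ncard_coe_finset]
  decide

/-- `3` is not a square in `ℤ`. [folklore] -/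
theorem int_sq_ne_three (y : ℤ) : y ^ 2 ≠ 3 := by
  intro h
  have h1 : -2 < y := by nlinarith
  have h2 : y < 2 := by nlinarith
  interval_cases y <;> omega

/-- `5` is not a square in `ℤ`. [folklore] -/
theorem int_sq_ne_five (y : ℤ) : y ^ 2 ≠ 5 := by
  intro h
  have h1 : -3 < y := by nlinarith
  have h2 : y < 3 := by nlinarith
  interval_cases y <;> omega

namespace Tunnell1983

/-- **`a(3) = 2`**, as printed (Tunnell 1983, p. 329: "Since `a(1) = 1` and `a(3) = 2` …";
`g θ₂ = q + 2q³ + ⋯`, p. 327): `#{2x²+y²+32z² = 3} = #{2x²+y²+8z² = 3} = 4`.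
[cite: Tunnell1983Congruent, p. 329] -/
theorem a_three : a 3 = 2 := by
  rw [a_def, Nat.cast_ofNat,
    ternaryFormRepCount_eq_four (by norm_num) (by norm_num) (by norm_num) int_sq_ne_three,
    ternaryFormRepCount_eq_four (by norm_num) (by norm_num) (by norm_num) int_sq_ne_three]
  norm_num

/-- **`b(5) = 2`** (`g θ₄ = q + 2q⁵ + ⋯`; the coefficient paired with `L(E¹⁰, 1)` on p. 329):
`#{4x²+y²+32z² = 5} = #{4x²+y²+8z² = 5} = 4`. [cite: Tunnell1983Congruent, p. 329] -/
theorem b_five : b 5 = 2 := by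
  rw [b_def, Nat.cast_ofNat,
    ternaryFormRepCount_eq_four (by norm_num) (by norm_num) (by norm_num) int_sq_ne_five,
    ternaryFormRepCount_eq_four (by norm_num) (by norm_num) (by norm_num) int_sq_ne_five]
  norm_num

/-- **"`a(n) = 0` unless `n ≡ 1` or `3` modulo `8`"** (Tunnell 1983, p. 329), for odd `n`:
if `n ≡ 5` or `7 (mod 8)` then both `#{2x²+y²+32z² = n}` and `#{2x²+y²+8z² = n}` vanish, as
`2x² + y² ∈ {0, 1, 2, 3, 4, 6} (mod 8)`. [cite: Tunnell1983Congruent, p. 329] -/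
theorem a_eq_zero_of_mod_eight {n : ℕ} (h : n % 8 = 5 ∨ n % 8 = 7) : a n = 0 := by
  rcases h with h | h
  · rw [a_def, ternaryFormRepCount_eq_zero_of_mod_eight h (by decide),
      ternaryFormRepCount_eq_zero_of_mod_eight h (by decide)]
    norm_num
  · rw [a_def, ternaryFormRepCount_eq_zero_of_mod_eight h (by decide),
      ternaryFormRepCount_eq_zero_of_mod_eight h (by decide)]
    norm_num

/-- **"`b(n) = 0` unless `n ≡ 1` or `5` modulo `8`"** (Tunnell 1983, p. 329), for odd `n`:
if `n ≡ 3` or `7 (mod 8)` then both `#{4x²+y²+32z² = n}` and `#{4x²+y²+8z² = n}` vanish, as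
`4x² + y² ∈ {0, 1, 4, 5} (mod 8)`. [cite: Tunnell1983Congruent, p. 329] -/
theorem b_eq_zero_of_mod_eight {n : ℕ} (h : n % 8 = 3 ∨ n % 8 = 7) : b n = 0 := by
  rcases h with h | h
  · rw [b_def, ternaryFormRepCount_eq_zero_of_mod_eight h (by decide),
      ternaryFormRepCount_eq_zero_of_mod_eight h (by decide)]
    norm_num
  · rw [b_def, ternaryFormRepCount_eq_zero_of_mod_eight h (by decide),
      ternaryFormRepCount_eq_zero_of_mod_eight h (by decide)]
    norm_num

end Tunnell1983

/-! ### The two inputs of the proof of Theorem 3 (named facts) -/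

/-- **Waldspurger's theorem specialised to `g θ₂ = ∑ a(n) qⁿ`** (Tunnell 1983, p. 329, for `n`
square-free): "`a(n)² = β₁² L(Eⁿ, 1) n^{1/2}`, `n ≡ 1 (8)`; `a(n)² = β₃² L(Eⁿ, 1) n^{1/2}`,
`n ≡ 3 (8)`; `a(n)² = 0 = A(n)² = L(Eⁿ, 1)`, `n ≡ 5, 7 (8)`", obtained from "Theorem
(Waldspurger [25, Theorem 1])" (p. 328) applied to the Shimura lift `φ` (level `32`) of the
eigenforms `g θ₂`, `g θ₈` of Theorem 2: `a(n) = β₁ A(n) n^{1/4}`, resp. `β₃ A(n) n^{1/4}`, with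
`A(t)²` proportional to `L(φ ⊗ χ_t, 1) = L(Eᵗ, 1)`, and `A(n) = 0` for `n ≡ 5, 7 (8)`. The
constants (here `c₁ = β₁²`, `c₃ = β₃²`) are unspecified complex numbers; `Eⁿ = congruentNumberCurve n`,
`a = Tunnell1983.a`, and `L(Eⁿ, 1)` is `entireLFunction 1` under the junk-value guard
`HasEntireLFunction`, as in `Tunnell1983_L_one_odd`. Needs forms of weight `3/2`, the Shimura
correspondence and Waldspurger (1981), none in Mathlib.
[cite: Tunnell1983Congruent, Theorem (Waldspurger) p. 328 and proof of Thm 3, p. 329] -/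
def Tunnell1983_a_sq_eq_const_mul_L_one : Prop :=
  ∃ c₁ c₃ : ℂ, ∀ ⦃n : ℕ⦄, Squarefree n → (congruentNumberCurve n).HasEntireLFunction →
    (n % 8 = 1 → (Tunnell1983.a n : ℂ) ^ 2 =
      c₁ * (congruentNumberCurve n).entireLFunction 1 * (Real.sqrt n : ℂ)) ∧
    (n % 8 = 3 → (Tunnell1983.a n : ℂ) ^ 2 =
      c₃ * (congruentNumberCurve n).entireLFunction 1 * (Real.sqrt n : ℂ)) ∧
    (n % 8 = 5 ∨ n % 8 = 7 → (congruentNumberCurve n).entireLFunction 1 = 0)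

/-- **Waldspurger's theorem specialised to `g θ₄ = ∑ b(n) qⁿ`** (Tunnell 1983, p. 329, character
`χ₂`, `n` square-free): "In this case, `A(t)² = L(φ χ₂ χ_t, 1) = L(E^{2t}, 1)`. Comparing the
Waldspurger basis with the basis `(g θ₄ - g θ₁₆), g θ₁₆` gives in this case that `A(n) = 0`
when `n ≡ 3, 7` modulo `8` and that `b(n) = γ₁ A(n) n^{1/4}`, `n ≡ 1 (8)`,
`b(n) = γ₅ A(n) n^{1/4}`, `n ≡ 5 (8)`." Squared: `b(n)² = γ₁² L(E^{2n}, 1) n^{1/2}` on the class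
`1`, `= γ₅² L(E^{2n}, 1) n^{1/2}` on the class `5`, and `L(E^{2n}, 1) = 0` on the classes `3, 7`
(constants `c₁ = γ₁²`, `c₅ = γ₅²` unspecified; `E^{2n} = congruentNumberCurve (2 * n)`,
`b = Tunnell1983.b`, junk-value guard as in `Tunnell1983_L_one_even`).
[cite: Tunnell1983Congruent, Theorem (Waldspurger) p. 328 and proof of Thm 3, p. 329] -/
def Tunnell1983_b_sq_eq_const_mul_L_one : Prop :=
  ∃ c₁ c₅ : ℂ, ∀ ⦃n : ℕ⦄, Squarefree n → (congruentNumberCurve (2 * n)).HasEntireLFunction →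
    (n % 8 = 1 → (Tunnell1983.b n : ℂ) ^ 2 =
      c₁ * (congruentNumberCurve (2 * n)).entireLFunction 1 * (Real.sqrt n : ℂ)) ∧
    (n % 8 = 5 → (Tunnell1983.b n : ℂ) ^ 2 =
      c₅ * (congruentNumberCurve (2 * n)).entireLFunction 1 * (Real.sqrt n : ℂ)) ∧
    (n % 8 = 3 ∨ n % 8 = 7 → (congruentNumberCurve (2 * n)).entireLFunction 1 = 0)

/-- **`L(E, 1) = β/4` and `L(E³, 1) = β/√3`** (Tunnell 1983, p. 329: "It is shown in
[3, Table 1] that `L(Eⁿ, 1) n^{1/2}/β` is rational … In particular `L(E, 1)/β = 1/4` and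
`L(E³, 1) 3^{1/2}/β = 1`"; Birch–Swinnerton-Dyer 1965, (1.6): `L_D(1) = D^{-1/4} ω σ(D)` for
`Γ_D : y² = x³ - Dx`, `D > 0`, with Table 1: `σ(1) = ¼`, `σ(9) = 1`; `E = Γ₁`, `E³ = Γ₉`,
`ω = β = tunnellPeriod`). Junk-value guards as in `Tunnell1983_L_one_odd`.
[cite: Tunnell1983Congruent, proof of Thm 3, p. 329]
[cite: BirchSwinnertonDyer1965NotesII, (1.6) p. 80 and Table 1 p. 101 (D = 1, 9)] -/
def BirchSwinnertonDyer1965_L_one_one_three : Prop :=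
  ((congruentNumberCurve 1).HasEntireLFunction →
    (congruentNumberCurve 1).entireLFunction 1 = ((tunnellPeriod / 4 : ℝ) : ℂ)) ∧
  ((congruentNumberCurve 3).HasEntireLFunction →
    (congruentNumberCurve 3).entireLFunction 1 = ((tunnellPeriod / Real.sqrt 3 : ℝ) : ℂ))

/-- **`L(E², 1) = β/(2√2)` and `L(E¹⁰, 1) = 2β/√10`**, the two values Tunnell reads off
"the tables of [3] to find `L(E², 1)` and `L(E¹⁰, 1)`" (p. 329): Birch–Swinnerton-Dyer 1965,
(1.6) `L_D(1) = D^{-1/4} ω σ(D)` (`D > 0`) and Table 1, whose `-D` columns also list the data of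
`Γ_{4D}` (p. 100, "These are also the values of `σ, g, λ₁, λ` respectively corresponding to
`-4D`"): `σ = ½` in row `1` and `σ = 2` in row `25`, so `L(Γ₄, 1) = 4^{-1/4} β/2 = β/(2√2)`
(also p. 87: `L₋₁(1) = ¼ ω √2` for the isogenous `Γ₋₁`) and `L(Γ₁₀₀, 1) = 100^{-1/4} · 2β = 2β/√10`;
here `E² = Γ₄ = congruentNumberCurve 2`, `E¹⁰ = Γ₁₀₀ = congruentNumberCurve 10`, `ω = β`. These
are the instances `d = 1, 5` of Theorem 3 (`b(1) = 1`, `b(5) = 2`). Junk-value guards as in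
`Tunnell1983_L_one_even`. [cite: Tunnell1983Congruent, proof of Thm 3, p. 329]
[cite: BirchSwinnertonDyer1965NotesII, (1.6) p. 80, p. 100 and Table 1 p. 101 (rows 1, 25, column -D)] -/
def BirchSwinnertonDyer1965_L_one_two_ten : Prop :=
  ((congruentNumberCurve 2).HasEntireLFunction →
    (congruentNumberCurve 2).entireLFunction 1 = ((tunnellPeriod / (2 * Real.sqrt 2) : ℝ) : ℂ)) ∧
  ((congruentNumberCurve 10).HasEntireLFunction →
    (congruentNumberCurve 10).entireLFunction 1 = ((2 * tunnellPeriod / Real.sqrt 10 : ℝ) : ℂ))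

/-! ### Theorem 3 from Waldspurger's proportionality and the four `L`-values -/

/-- The odd residues modulo `8`. [folklore] -/
theorem mod_eight_of_odd {d : ℕ} (hd : Odd d) : d % 8 = 1 ∨ d % 8 = 3 ∨ d % 8 = 5 ∨ d % 8 = 7 := by
  have := Nat.odd_iff.1 hd
  omega

/-- **Tunnell 1983, Theorem 3 (odd twists) from its printed inputs** (p. 329): Waldspurger's
proportionality for `g θ₂` (`hW : Tunnell1983_a_sq_eq_const_mul_L_one`), the values
`L(E, 1) = β/4`, `L(E³, 1) = β/√3` (`hV : BirchSwinnertonDyer1965_L_one_one_three`) and the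
continuation of `L(E_n, s)` for squarefree `n` (`hL`, used at `n = 1, 3` only). Proof as
printed: "Since `a(1) = 1` and `a(3) = 2` this shows that `4/β = β₁² = β₃²`", so on the classes
`1, 3 (mod 8)` `L(E^d, 1) = a(d)²/(β₁² √d) = a(d)² β d^{-1/2}/4`; on the classes `5, 7`,
`L(E^d, 1) = 0` (Waldspurger) and `a(d) = 0` (`Tunnell1983.a_eq_zero_of_mod_eight`).
[cite: Tunnell1983Congruent, Thm 3 and its proof, pp. 328–329] -/
theorem Tunnell1983_L_one_odd_of_facts (hW : Tunnell1983_a_sq_eq_const_mul_L_one)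
    (hV : BirchSwinnertonDyer1965_L_one_one_three) (hL : hasEntireLFunction_congruentNumberCurve) :
    Tunnell1983_L_one_odd := by
  obtain ⟨c₁, c₃, hW⟩ := hW
  intro d hd hodd hLd
  have hβ : (tunnellPeriod : ℂ) ≠ 0 := Complex.ofReal_ne_zero.2 tunnellPeriod_ne_zero
  have hd0 : (0 : ℝ) < d := by exact_mod_cast Nat.pos_of_ne_zero hd.ne_zero
  have hsd : (Real.sqrt d : ℂ) ≠ 0 := Complex.ofReal_ne_zero.2 (Real.sqrt_pos.2 hd0).ne'
  rcases mod_eight_of_odd hodd with h8 | h8 | h8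
  · -- `d ≡ 1 (mod 8)`: compare with `n = 1`
    have h1L : (congruentNumberCurve 1).HasEntireLFunction := hL squarefree_one
    have e1 := (hW squarefree_one h1L).1 rfl
    have ed := (hW hd hLd).1 h8
    rw [Tunnell1983.a_one, hV.1 h1L, Nat.cast_one, Real.sqrt_one] at e1
    push_cast at e1 ed ⊢
    have hc : c₁ = 4 / (tunnellPeriod : ℂ) := by
      field_simp
      linear_combination -4 * e1
    rw [hc] at ed
    field_simp at ed
    field_simp
    linear_combination -ed
  · -- `d ≡ 3 (mod 8)`: compare with `n = 3`
    have h3L : (congruentNumberCurve 3).HasEntireLFunction := hL Nat.prime_three.prime.squarefree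
    have e3 := (hW Nat.prime_three.prime.squarefree h3L).2.1 rfl
    have ed := (hW hd hLd).2.1 h8
    have hs3 : (Real.sqrt 3 : ℂ) ≠ 0 := Complex.ofReal_ne_zero.2 (by positivity)
    rw [Tunnell1983.a_three, hV.2 h3L, Nat.cast_ofNat] at e3
    push_cast at e3 ed ⊢
    have hc : c₃ = 4 / (tunnellPeriod : ℂ) := by
      field_simp
      field_simp at e3
      linear_combination -e3
    rw [hc] at ed
    field_simp at ed
    field_simp
    linear_combination -ed
  · -- `d ≡ 5, 7 (mod 8)`: both sides vanish
    rw [(hW hd hLd).2.2 h8, Tunnell1983.a_eq_zero_of_mod_eight h8]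
    simp

/-- **Tunnell 1983, Theorem 3 (even twists) from its printed inputs** (p. 329): Waldspurger's
proportionality for `g θ₄` (`hW : Tunnell1983_b_sq_eq_const_mul_L_one`), the values
`L(E², 1) = β/(2√2)`, `L(E¹⁰, 1) = 2β/√10` (`hV : BirchSwinnertonDyer1965_L_one_two_ten`) and
the continuation of `L(E_n, s)` for squarefree `n` (`hL`, used at `n = 2, 10` only): from
`b(1) = 1`, `b(5) = 2` one gets `γ₁² = γ₅² = 2√2/β`, so on the classes `1, 5 (mod 8)`
`L(E^{2d}, 1) = b(d)² β/(2√2 √d) = b(d)² β (2d)^{-1/2}/2`; on the classes `3, 7`,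
`L(E^{2d}, 1) = 0` (Waldspurger) and `b(d) = 0` (`Tunnell1983.b_eq_zero_of_mod_eight`) ("Using
this to compute `L(E^{2n}, 1)`, and comparing with the tables of [3] to find `L(E², 1)` and
`L(E¹⁰, 1)` verifies the theorem"). [cite: Tunnell1983Congruent, Thm 3 and its proof, pp. 328–329] -/
theorem Tunnell1983_L_one_even_of_facts (hW : Tunnell1983_b_sq_eq_const_mul_L_one)
    (hV : BirchSwinnertonDyer1965_L_one_two_ten) (hL : hasEntireLFunction_congruentNumberCurve) :
    Tunnell1983_L_one_even := by
  obtain ⟨c₁, c₅, hW⟩ := hW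
  intro d hd hodd hLd
  have hβ : (tunnellPeriod : ℂ) ≠ 0 := Complex.ofReal_ne_zero.2 tunnellPeriod_ne_zero
  have hd0 : (0 : ℝ) < d := by exact_mod_cast Nat.pos_of_ne_zero hd.ne_zero
  have hsd : (Real.sqrt d : ℂ) ≠ 0 := Complex.ofReal_ne_zero.2 (Real.sqrt_pos.2 hd0).ne'
  have hs2 : (Real.sqrt 2 : ℂ) ≠ 0 := Complex.ofReal_ne_zero.2 (by positivity)
  have hsq2 : Squarefree 2 := Nat.prime_two.prime.squarefree
  have hsq10 : Squarefree 10 :=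
    (Nat.squarefree_mul (by norm_num : Nat.Coprime 2 5)).2
      ⟨Nat.prime_two.prime.squarefree, Nat.prime_five.prime.squarefree⟩
  rw [Real.sqrt_mul (by norm_num : (0 : ℝ) ≤ 2)]
  rcases mod_eight_of_odd hodd with h8 | h8 | h8 | h8
  · -- `d ≡ 1 (mod 8)`: compare with `n = 1`, `E^{2·1} = E²`
    have h2L : (congruentNumberCurve 2).HasEntireLFunction := hL hsq2
    have e1 := (hW squarefree_one h2L).1 rfl
    have ed := (hW hd hLd).1 h8
    rw [Tunnell1983.b_one, Nat.cast_one, Real.sqrt_one] at e1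
    simp only [mul_one] at e1
    rw [hV.1 h2L] at e1
    push_cast at e1 ed ⊢
    have hc : c₁ = 2 * (Real.sqrt 2 : ℂ) / (tunnellPeriod : ℂ) := by
      field_simp
      field_simp at e1
      linear_combination -e1
    rw [hc] at ed
    field_simp at ed
    field_simp
    linear_combination -ed
  · -- `d ≡ 3 (mod 8)`: both sides vanish
    rw [(hW hd hLd).2.2 (Or.inl h8), Tunnell1983.b_eq_zero_of_mod_eight (Or.inl h8)]
    simp
  · -- `d ≡ 5 (mod 8)`: compare with `n = 5`, `E^{2·5} = E¹⁰`
    have h10L : (congruentNumberCurve 10).HasEntireLFunction := hL hsq10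
    have e5 := (hW Nat.prime_five.prime.squarefree h10L).2.1 rfl
    have ed := (hW hd hLd).2.1 h8
    have hs5 : (Real.sqrt 5 : ℂ) ≠ 0 := Complex.ofReal_ne_zero.2 (by positivity)
    rw [Tunnell1983.b_five, Nat.cast_ofNat] at e5
    simp only [show (2 * 5 : ℕ) = 10 from rfl] at e5
    rw [hV.2 h10L, show (10 : ℝ) = 2 * 5 by norm_num,
      Real.sqrt_mul (by norm_num : (0 : ℝ) ≤ 2)] at e5
    push_cast at e5 ed ⊢
    have hc : c₅ = 2 * (Real.sqrt 2 : ℂ) / (tunnellPeriod : ℂ) := by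
      field_simp
      field_simp at e5
      linear_combination -e5
    rw [hc] at ed
    field_simp at ed
    field_simp
    linear_combination -ed
  · -- `d ≡ 7 (mod 8)`: both sides vanish
    rw [(hW hd hLd).2.2 (Or.inr h8), Tunnell1983.b_eq_zero_of_mod_eight (Or.inr h8)]
    simp

/-! ### Theorem 3 gives back both inputs: the equivalence web of this file's named facts

Tunnell's proof (p. 329) pins the Waldspurger constants from four `L`-values: "Since `a(1) = 1`
and `a(3) = 2` this shows that `4/β = β₁² = β₃²`". Conversely, Theorem 3 as printed EXHIBITS
constants for Waldspurger's proportionality (`c₁ = c₃ = 4/β`, resp. `2√2/β` in the even case)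
and, at `d = 1, 3` (resp. `d = 1, 5`), returns the four `L`-values of Birch–Swinnerton-Dyer's
Table 1. So, over the continuation of `L(E_n, s)` for squarefree `n`, Theorem 3 (odd, resp.
even) is EQUIVALENT to the conjunction of the two named facts it was proved from
(`Tunnell1983_L_one_odd_iff_facts`, `Tunnell1983_L_one_even_iff_facts`): a discharge of
`Tunnell1983_L_one_odd/even` by any route discharges `Tunnell1983_a/b_sq_eq_const_mul_L_one`
and `BirchSwinnertonDyer1965_L_one_one_three/two_ten` as well. -/

/-- **Waldspurger's proportionality (odd case) from Theorem 3**, with the constants Tunnell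
computes on p. 329, `β₁² = β₃² = 4/β`: if `L(E^d, 1) = a(d)² β d^{-1/2}/4` for all odd
square-free `d`, then `a(n)² = (4/β) L(Eⁿ, 1) √n` on the classes `1, 3 (mod 8)`, and
`L(Eⁿ, 1) = 0` on the classes `5, 7` because `a(n) = 0` there
(`Tunnell1983.a_eq_zero_of_mod_eight`). [cite: Tunnell1983Congruent, Thm 3 and its proof, pp. 328–329] -/
theorem Tunnell1983_a_sq_eq_const_mul_L_one_of_L_one_odd (hT : Tunnell1983_L_one_odd) :
    Tunnell1983_a_sq_eq_const_mul_L_one := by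
  have hβ : (tunnellPeriod : ℂ) ≠ 0 := Complex.ofReal_ne_zero.2 tunnellPeriod_ne_zero
  refine ⟨4 / (tunnellPeriod : ℂ), 4 / (tunnellPeriod : ℂ), fun n hn hLn ↦ ?_⟩
  have hn0 : (0 : ℝ) < n := by exact_mod_cast Nat.pos_of_ne_zero hn.ne_zero
  have hsn : (Real.sqrt n : ℂ) ≠ 0 := Complex.ofReal_ne_zero.2 (Real.sqrt_pos.2 hn0).ne'
  have key : n % 8 = 1 ∨ n % 8 = 3 ∨ n % 8 = 5 ∨ n % 8 = 7 →
      (congruentNumberCurve n).entireLFunction 1 =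
        (((Tunnell1983.a n : ℝ) ^ 2 * tunnellPeriod / (4 * Real.sqrt n) : ℝ) : ℂ) :=
    fun h8 ↦ hT hn (Nat.odd_iff.2 (by omega)) hLn
  refine ⟨fun h8 ↦ ?_, fun h8 ↦ ?_, fun h8 ↦ ?_⟩
  · rw [key (Or.inl h8)]
    push_cast
    field_simp
  · rw [key (Or.inr (Or.inl h8))]
    push_cast
    field_simp
  · rw [key (Or.inr (Or.inr h8)), Tunnell1983.a_eq_zero_of_mod_eight h8]
    push_cast
    ring

/-- **`L(E, 1) = β/4` and `L(E³, 1) = β/√3` from Theorem 3** at `d = 1, 3` (`a(1) = 1`,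
`a(3) = 2`: "In particular `L(E, 1)/β = 1/4` and `L(E³, 1) 3^{1/2}/β = 1`", p. 329).
[cite: Tunnell1983Congruent, Thm 3 and its proof, pp. 328–329] -/
theorem BirchSwinnertonDyer1965_L_one_one_three_of_L_one_odd (hT : Tunnell1983_L_one_odd) :
    BirchSwinnertonDyer1965_L_one_one_three := by
  refine ⟨fun h1 ↦ ?_, fun h3 ↦ ?_⟩
  · rw [hT squarefree_one odd_one h1, Tunnell1983.a_one]
    congr 1
    push_cast
    rw [Real.sqrt_one]
    ring
  · have hs3 : Real.sqrt 3 ≠ 0 := by positivity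
    rw [hT Nat.prime_three.prime.squarefree (Nat.odd_iff.2 rfl) h3, Tunnell1983.a_three]
    congr 1
    push_cast
    field_simp
    ring

/-- **Theorem 3 (odd twists) is equivalent to the conjunction of its two printed inputs** —
Waldspurger's proportionality for `g θ₂` and the `L`-values `L(E, 1) = β/4`, `L(E³, 1) = β/√3`
— over the continuation of `L(E_n, s)` for squarefree `n` (`hL`, needed only in the direction
`Tunnell1983_L_one_odd_of_facts`, at `n = 1, 3`). [cite: Tunnell1983Congruent, Thm 3 and its proof, pp. 328–329] -/
theorem Tunnell1983_L_one_odd_iff_facts (hL : hasEntireLFunction_congruentNumberCurve) :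
    Tunnell1983_L_one_odd ↔
      Tunnell1983_a_sq_eq_const_mul_L_one ∧ BirchSwinnertonDyer1965_L_one_one_three :=
  ⟨fun h ↦ ⟨Tunnell1983_a_sq_eq_const_mul_L_one_of_L_one_odd h,
      BirchSwinnertonDyer1965_L_one_one_three_of_L_one_odd h⟩,
    fun h ↦ Tunnell1983_L_one_odd_of_facts h.1 h.2 hL⟩

/-- **Waldspurger's proportionality (even case, character `χ₂`) from Theorem 3**, with the
constants `γ₁² = γ₅² = 2√2/β`: if `L(E^{2d}, 1) = b(d)² β (2d)^{-1/2}/2` for all odd square-free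
`d`, then `b(n)² = (2√2/β) L(E²ⁿ, 1) √n` on the classes `1, 5 (mod 8)`, and `L(E²ⁿ, 1) = 0` on
the classes `3, 7` because `b(n) = 0` there (`Tunnell1983.b_eq_zero_of_mod_eight`).
[cite: Tunnell1983Congruent, Thm 3 and its proof, pp. 328–329] -/
theorem Tunnell1983_b_sq_eq_const_mul_L_one_of_L_one_even (hT : Tunnell1983_L_one_even) :
    Tunnell1983_b_sq_eq_const_mul_L_one := by
  have hβ : (tunnellPeriod : ℂ) ≠ 0 := Complex.ofReal_ne_zero.2 tunnellPeriod_ne_zero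
  have hs2 : (Real.sqrt 2 : ℂ) ≠ 0 := Complex.ofReal_ne_zero.2 (by positivity)
  refine ⟨2 * (Real.sqrt 2 : ℂ) / (tunnellPeriod : ℂ), 2 * (Real.sqrt 2 : ℂ) / (tunnellPeriod : ℂ),
    fun n hn hLn ↦ ?_⟩
  have hn0 : (0 : ℝ) < n := by exact_mod_cast Nat.pos_of_ne_zero hn.ne_zero
  have hsn : (Real.sqrt n : ℂ) ≠ 0 := Complex.ofReal_ne_zero.2 (Real.sqrt_pos.2 hn0).ne'
  have key : n % 8 = 1 ∨ n % 8 = 3 ∨ n % 8 = 5 ∨ n % 8 = 7 →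
      (congruentNumberCurve (2 * n)).entireLFunction 1 =
        (((Tunnell1983.b n : ℝ) ^ 2 * tunnellPeriod / (2 * (Real.sqrt 2 * Real.sqrt n)) : ℝ) : ℂ) := by
    intro h8
    rw [← Real.sqrt_mul (by norm_num : (0 : ℝ) ≤ 2)]
    exact hT hn (Nat.odd_iff.2 (by omega)) hLn
  refine ⟨fun h8 ↦ ?_, fun h8 ↦ ?_, fun h8 ↦ ?_⟩
  · rw [key (Or.inl h8)]
    push_cast
    field_simp
  · rw [key (Or.inr (Or.inr (Or.inl h8)))]
    push_cast
    field_simp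
  · rw [key (by omega), Tunnell1983.b_eq_zero_of_mod_eight h8]
    push_cast
    ring

/-- **`L(E², 1) = β/(2√2)` and `L(E¹⁰, 1) = 2β/√10` from Theorem 3** at `d = 1, 5`
(`b(1) = 1`, `b(5) = 2`; "comparing with the tables of [3] to find `L(E², 1)` and `L(E¹⁰, 1)`
verifies the theorem", p. 329). [cite: Tunnell1983Congruent, Thm 3 and its proof, pp. 328–329] -/
theorem BirchSwinnertonDyer1965_L_one_two_ten_of_L_one_even (hT : Tunnell1983_L_one_even) :
    BirchSwinnertonDyer1965_L_one_two_ten := by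
  refine ⟨fun h2 ↦ ?_, fun h10 ↦ ?_⟩
  · have e : (congruentNumberCurve (2 * 1)).entireLFunction 1 = _ := hT squarefree_one odd_one h2
    rw [Tunnell1983.b_one] at e
    rw [show (2 : ℕ) = 2 * 1 from rfl, e]
    congr 1
    push_cast
    ring
  · have hs10 : Real.sqrt 10 ≠ 0 := by positivity
    have e : (congruentNumberCurve (2 * 5)).entireLFunction 1 = _ :=
      hT Nat.prime_five.prime.squarefree (Nat.odd_iff.2 rfl) h10
    rw [Tunnell1983.b_five] at e
    rw [show (10 : ℕ) = 2 * 5 from rfl, e]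
    congr 1
    push_cast
    rw [show (2 : ℝ) * 5 = 10 by norm_num]
    field_simp

/-- **Theorem 3 (even twists) is equivalent to the conjunction of its two printed inputs** —
Waldspurger's proportionality for `g θ₄` and the `L`-values `L(E², 1)`, `L(E¹⁰, 1)` — over the
continuation of `L(E_n, s)` for squarefree `n` (`hL`, used at `n = 2, 10` only).
[cite: Tunnell1983Congruent, Thm 3 and its proof, pp. 328–329] -/
theorem Tunnell1983_L_one_even_iff_facts (hL : hasEntireLFunction_congruentNumberCurve) :
    Tunnell1983_L_one_even ↔
      Tunnell1983_b_sq_eq_const_mul_L_one ∧ BirchSwinnertonDyer1965_L_one_two_ten :=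
  ⟨fun h ↦ ⟨Tunnell1983_b_sq_eq_const_mul_L_one_of_L_one_even h,
      BirchSwinnertonDyer1965_L_one_two_ten_of_L_one_even h⟩,
    fun h ↦ Tunnell1983_L_one_even_of_facts h.1 h.2 hL⟩

end Literature.NumberTheory.EllipticCurves

end
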